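import Literature.Barriers.QuantumAdvantage.LinearXEBSpoofing

/-!
# Barrier catalogue `QuantumAdvantage` — annotation to `LinearXEBSpoofing`: circuit-blind samplers score zero

Topic `Literature/Barriers/QuantumAdvantage` (D-0021). This file sharpens the scope of the catalogued
barrier `LinearXEBSpoofing` ("the linear cross-entropy benchmark can be spoofed") on the OTHER side:
a classical sampler whose output law carries no information about the specific circuit `C` cannot
score on the linear cross-entropy benchmark `F_q(p) = N · Σₓ q(x) p(x) − 1` (`linearXEB`,
[cite: BarakChouGao2021, §1]) at all.

BARRIER-ANNOTATION: scope of `LinearXEBSpoofing`, instance-level adjudication (pub cell `pub-qadeq`,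
claim S-01). The unrefereed claim [cite: Oh2026, (abstract and Thm 1)] is that an `O(n)`-time
"frozen-tree" sampler, whose output distribution `p_F` is a flat-Dirichlet vector drawn
INDEPENDENTLY of the circuit, "refutes quantum advantage of random circuit sampling" because
"no statistical test acting on samples alone can distinguish" it from the device. The benchmark the
RCS experiments actually report is not a samples-alone statistic: it is `F_q` evaluated against the
ideal probabilities `q = q_C` of the KNOWN circuit. The elementary averaging identity below
(`sum_mul_linearXEB_eq_zero_of_mean_uniform`) shows that any mixture of spoofer distributions whose
mean is the uniform distribution — in particular any sampler independent of `C` whose law is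
symmetric under relabelling of outcomes, such as the flat Dirichlet / frozen tree, for which
`E[p_F(x)] = 1/N` for every `x` — has mean linear XEB EXACTLY `0` against every ideal `q`, i.e. the
score of the trivial uniform sampler (`linearXEB_uniform`), whereas the experiments report
`F_XEB ≈ 1.5 × 10⁻³` at `67` qubits / `32` cycles [cite: MorvanEtAl2024, (abstract)] resolved from zero
at high statistical significance. So the frozen-tree sampler is not an XEB spoofer; what it
reproduces is the Porter–Thomas histogram of `{N q_C(x)}`, which the uniform-mean identity shows is
irrelevant to `F_q`. (Numerical companion, two independent implementations of the sampler against
exact `n ≤ 20` statevectors: pub-qadeq SPOOF-S01.md, compute job recorded there.)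

## Contents (real proofs)

* `sum_mul_linearXEB_eq_zero_of_mean_uniform` — for weights `w` on a finite index set with `Σ w = 1`
  and spoofer distributions `p i` with uniform mean `Σ_i w_i p_i(x) = 1/N`, `Σ_i w_i F_q(p_i) = 0`
  for every `q` with `Σ q = 1` (no sign hypotheses are needed: the identity is linear).
* `linearXEB_eq_zero_of_forall_eq_uniform` — the one-point case (a sampler that is itself uniform on
  average over nothing, i.e. `p = 1/N`), restated through the mixture lemma as a sanity check.

## References

* [Oh2026] S. Oh, *Frozen-Tree Sampling Refutes Quantum Advantage of Random Circuit Sampling*,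
  arXiv:2607.04054v1 (2026) — the adjudicated claim (unrefereed).
* [BarakChouGao2021] B. Barak, C.-N. Chou, X. Gao, *Spoofing Linear Cross-Entropy Benchmarking in
  Shallow Quantum Circuits*, ITCS 2021, §1 — definition of `F_C(p)`.
* [MorvanEtAl2024] A. Morvan et al., *Phase transitions in random circuit sampling*, Nature 634
  (2024) 328–333 — the benchmark values the claim would have to reproduce.
-/

open Finset

namespace Literature.Barriers.QuantumAdvantage

variable {α : Type*} [Fintype α]

/-- **Mixtures with uniform mean score zero on linear XEB.** Let `q` be any ideal distribution
(`Σ q = 1`) on a finite outcome space with `N` points, and let `(p i)_{i ∈ s}` be spoofer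
distributions mixed with weights `w i`, `Σ_{i∈s} w i = 1`, whose mean is uniform:
`Σ_{i∈s} w i · p i x = 1/N` for every outcome `x` (e.g. the law of a sampler that is independent of
the circuit and symmetric under relabelling outcomes). Then the mean benchmark value vanishes:
`Σ_{i∈s} w i · F_q(p i) = 0`. Purely linear bookkeeping on the definition of
[cite: BarakChouGao2021, §1]; this is the identity that places the sampler of Oh (arXiv:2607.04054)
at the score of the uniform distribution. [folklore] -/
theorem sum_mul_linearXEB_eq_zero_of_mean_uniform [Nonempty α] {ι : Type*} (s : Finset ι)
    (w : ι → ℝ) (p : ι → α → ℝ) (q : α → ℝ) (hq : ∑ x, q x = 1) (hw : ∑ i ∈ s, w i = 1)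
    (hmean : ∀ x, ∑ i ∈ s, w i * p i x = (Fintype.card α : ℝ)⁻¹) :
    ∑ i ∈ s, w i * linearXEB q (p i) = 0 := by
  have hN : (Fintype.card α : ℝ) ≠ 0 := by exact_mod_cast Fintype.card_ne_zero
  have h1 : ∀ i ∈ s, w i * linearXEB q (p i)
      = (Fintype.card α : ℝ) * (∑ x, q x * (w i * p i x)) - w i := by
    intro i _
    unfold linearXEB
    rw [mul_sub, mul_one]
    simp only [Finset.mul_sum]
    congr 1
    exact Finset.sum_congr rfl fun x _ => by ring
  have h2 : ∀ x ∈ (Finset.univ : Finset α),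
      ∑ i ∈ s, q x * (w i * p i x) = q x * (Fintype.card α : ℝ)⁻¹ := by
    intro x _
    rw [← Finset.mul_sum, hmean x]
  rw [Finset.sum_congr rfl h1, Finset.sum_sub_distrib, hw, ← Finset.mul_sum, Finset.sum_comm,
    Finset.sum_congr rfl h2, ← Finset.sum_mul, hq, one_mul, mul_inv_cancel₀ hN, sub_self]

/-- Sanity check / one-point case: a single spoofer equal to the uniform distribution scores `0`,
recovered from the mixture identity with the one-element index set (agrees with
`linearXEB_uniform`). [folklore] -/
theorem linearXEB_eq_zero_of_forall_eq_uniform [Nonempty α] (q p : α → ℝ) (hq : ∑ x, q x = 1)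
    (hp : ∀ x, p x = (Fintype.card α : ℝ)⁻¹) : linearXEB q p = 0 := by
  have h := sum_mul_linearXEB_eq_zero_of_mean_uniform (ι := Unit) {()} (fun _ => (1 : ℝ))
    (fun _ => p) q hq (by simp) (fun x => by simp [hp x])
  simpa using h

end Literature.Barriers.QuantumAdvantage
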